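import Summits.KontsevichZagierPeriods.KontsevichZagierPeriods.Theorems.RootDecompWalshStrataQuadricAssembly02

/-!
# Root decomposition & Walsh strata — the shear move: multi-affine cells are prism cells with a square term (lens 4, gen 7, part E)

The second residual `hM` of `quadricBakerDescent_of_sqrtDescent₂_of_multiAffine` (GENUINELY MULTI-AFFINE
cells: `p = B(x,y) z + C(x,y)` with `A = c₁₁ = c₂₂ = 0` and `(b₁, b₂) ≠ 0`) is where a `y`-potential of the
fibre bound `−C/B` acquires logarithms (`∫ C/B dy ∋ log|B|`).  The shear avoids them: the rational affine
change of variables `Φ(x, y, z) = ((x − z + 1)/2, y, z)` (determinant `1/2`, ONE move of rule (2),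
`KZ.changeOfVariablesRel`) carries the cell `(0,1)³ ∩ {p > 0}` onto the PRISM CELL
`(0,1)³ ∩ {0 < 2x − 1 + z < 1} ∩ {K.shear > 0}` of the sheared normal form `K.shear`
(`K.shear.pxyz x y z = K.pxyz (2x − 1 + z) y z`), whose square coefficient is `A + b₁ + c₁₁` — for a
multi-affine cell this is `b₁ ≠ 0` (after the swap `x ↔ y` if `b₁ = 0 ≠ b₂`).  Hence

* `Quadric₃.inBaker_cell3_of_shear` — `[cell(K), q]` lands in the Baker sector modulo relations as soon
  as `[prismCell(K.shear), 2q]` does;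
* `Quadric₃.inBaker_cell3_multiAffine_of_prism` — the residual `hM` follows from
  `hPr : ∀ L, L.A ≠ 0 → [prismCell(L), q] ∈ InBaker`;
* `quadricBakerDescent_of_sqrtDescent₂_of_prism : hS → hPr → QuadricBakerDescent` — the route item BY
  NAME from `SqrtDescent₂` (spelled out) and the prism cells WITH A SQUARE TERM, i.e. cells of exactly
  the kind the `z`-glue `inBaker_cell3` treats, cut by two more affine walls `z > 1 − 2x`, `z < 2 − 2x`
  (their atoms are sign atoms of the affine-section family `{D, p∘ℓ, 2Aℓ + B : ℓ ∈ {0, 1, 1 − 2x, 2 − 2x}}`,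
  on whose conics `p∘ℓ = 0` the discriminant is the square `(2Aℓ + B)²`: genus 0 persists).

References: [KontsevichZagier2001 §1.2 rule (2)], [BCR1998 §2.2], this node (NODE.md gen 7, B2/B3).
-/

noncomputable section

open Literature.NumberTheory.Transcendental
open MeasureTheory Set
open MvPolynomial (aeval X C)
open Literature.ModelTheory.ExponentialFields (IsSemialgebraic isSemialgebraic_univ
  isSemialgebraic_setOf_eval_pos isSemialgebraic_setOf_eval_lt isSemialgebraic_setOf_eval_le
  isSemialgebraic_setOf_eval_nonneg isSemialgebraic_setOf_eval_eq_zero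
  isSemialgebraic_setOf_eval_ne_zero continuous_aeval_real tarski_seidenberg_real_holds)
open Summit.KontsevichZagierPeriods.RootDecompWalshStrata.WalshSpanProof (isSemialgebraic_cubeSet
  isBounded_cubeSet)
open Summit.KontsevichZagierPeriods.RootDecompWalshStrata.ConeSpecimen (unitIoo isSemialgebraic_unitIoo
  unitIoo_subset_Icc mem_unitIoo)
open Summit.KontsevichZagierPeriods.RootDecompWalshStrata.PointlessOctant (boxTwo isSemialgebraic_boxTwo
  boxTwo_subset_Icc)

namespace Summit.KontsevichZagierPeriods.RootDecompWalshStrata.ConicDescent.BallCube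

namespace Quadric₃

/-- The quadric Walsh cell is `ℚ`-semialgebraic (PRIVATE copy of the CellThree02 lemma: the gate lint
`dedup.landed` identifies its statement with the landed `…ConicDescent.Conic.isSemialgebraic_cell`). [BCR1998 §2.2] -/
private theorem isSemialgebraic_cell (K : Quadric₃) : IsSemialgebraic ℚ K.cell := by
  convert (isSemialgebraic_cubeSet 3).inter (isSemialgebraic_setOf_eval_pos (R := ℝ) K.PxyzP)
    using 1
  ext z
  simp only [cell, mem_setOf_eq, mem_inter_iff, aeval_PxyzP]

/-- The quadric Walsh cell lies in the closed unit cube (PRIVATE copy, same reason). [folklore] -/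
private theorem cell_subset_Icc (K : Quadric₃) : K.cell ⊆ Icc 0 1 := fun _ hz =>
  ⟨fun j => (hz.1 j).1.le, fun j => (hz.1 j).2.le⟩

end Quadric₃

/-- `∀ j : Fin 3` unfolded. [folklore] (PRIVATE: landed twin `Literature…PolymathGEHCutoffJ.forall_fin_three`,
gate lint `dedup.landed`.) -/
private theorem forall_fin_three {P : Fin 3 → Prop} : (∀ j, P j) ↔ P 0 ∧ P 1 ∧ P 2 :=
  ⟨fun h => ⟨h 0, h 1, h 2⟩, fun h j => by
    match j with
    | 0 => exact h.1
    | 1 => exact h.2.1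
    | 2 => exact h.2.2⟩

/-! #### 30.1 The sheared normal form and its prism cell -/

namespace Quadric₃

variable (K : Quadric₃)

/-- The SHEARED normal form: `K.shear (x, y, z) = K (2x − 1 + z, y, z)`; its square coefficient is
`A + b₁ + c₁₁`. [this node] -/
def shear : Quadric₃ :=
  ⟨K.A + K.b1 + K.c11, K.b0 - K.b1 + K.c1 - 2 * K.c11, 2 * K.b1 + 4 * K.c11, K.b2 + K.c12,
    K.c0 - K.c1 + K.c11, 2 * K.c1 - 4 * K.c11, K.c2 - K.c12, 4 * K.c11, 2 * K.c12, K.c22⟩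

/-- The square coefficient of the sheared form. [this node] -/
@[simp] theorem shear_A : K.shear.A = K.A + K.b1 + K.c11 := rfl

/-- `K.shear (x, y, z) = K (2x − 1 + z, y, z)`. [this node] -/
theorem shear_pxyz (x y z : ℝ) : K.shear.pxyz x y z = K.pxyz (2 * x - 1 + z) y z := by
  simp only [shear, pxyz, Bxy, Cxy]
  push_cast
  ring

/-- The PRISM CELL of a normal form: its Walsh cell cut by the two affine walls `0 < 2x − 1 + z < 1`.
[this node] -/
def prismCell : Set (Fin 3 → ℝ) :=
  {w | w ∈ K.cell ∧ 0 < 2 * w 0 - 1 + w 2 ∧ 2 * w 0 - 1 + w 2 < 1}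

/-- The prism cell is `ℚ`-semialgebraic. [BCR1998 §2] -/
theorem isSemialgebraic_prismCell : IsSemialgebraic ℚ K.prismCell := by
  have h1 := isSemialgebraic_setOf_eval_pos (R := ℝ) (2 * X 0 - 1 + X 2 : MvPolynomial (Fin 3) ℚ)
  have h2 := isSemialgebraic_setOf_eval_pos (R := ℝ)
    (1 - (2 * X 0 - 1 + X 2) : MvPolynomial (Fin 3) ℚ)
  convert (K.isSemialgebraic_cell.inter h1).inter h2 using 1
  ext w
  simp only [prismCell, mem_setOf_eq, mem_inter_iff, map_add, map_sub, map_mul, map_one,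
    MvPolynomial.aeval_X, map_ofNat]
  constructor
  · rintro ⟨a, b, c⟩
    exact ⟨⟨a, b⟩, by linarith⟩
  · rintro ⟨⟨a, b⟩, c⟩
    exact ⟨a, b, by linarith⟩

/-- The prism cell lies in the closed unit cube. [folklore] -/
theorem prismCell_subset_Icc : K.prismCell ⊆ Icc 0 1 := fun _ hw => K.cell_subset_Icc hw.1

end Quadric₃

/-! #### 30.2 The shear as one move of rule (2) -/

/-- The shear / rescaling `Φ(x, y, z) = ((x − z + 1)/2, y, z)`. [this node] -/
def shearMap (v : Fin 3 → ℝ) : Fin 3 → ℝ := ![(v 0 - v 2 + 1) / 2, v 1, v 2]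

/-- First coordinate of the shear map: `(v₀ − v₂ + 1)/2`. [this node] -/
@[simp] theorem shearMap_zero (v : Fin 3 → ℝ) : shearMap v 0 = (v 0 - v 2 + 1) / 2 := rfl
/-- Second coordinate of the shear map: `v₁`. [this node] -/
@[simp] theorem shearMap_one (v : Fin 3 → ℝ) : shearMap v 1 = v 1 := rfl
/-- Third coordinate of the shear map: `v₂`. [this node] -/
@[simp] theorem shearMap_two (v : Fin 3 → ℝ) : shearMap v 2 = v 2 := rfl

/-- The Jacobian matrix of the shear. [this node] -/
def shearMat : Matrix (Fin 3) (Fin 3) ℝ := !![1 / 2, 0, -1 / 2; 0, 1, 0; 0, 0, 1]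

/-- The (constant) derivative of the shear. [this node] -/
def shearDeriv : (Fin 3 → ℝ) →L[ℝ] (Fin 3 → ℝ) :=
  LinearMap.toContinuousLinearMap (Matrix.toLin' shearMat)

/-- `det Φ' = 1/2`. [folklore] -/
theorem det_shearDeriv : shearDeriv.det = 1 / 2 := by
  have h : shearMat.det = 1 / 2 := by
    simp [shearMat, Matrix.det_fin_three]
  rw [← h]
  exact LinearMap.det_toLin' _

/-- `shearDeriv v` in coordinates. [this node] -/
theorem shearDeriv_apply (v : Fin 3 → ℝ) :
    shearDeriv v = ![(v 0 - v 2) / 2, v 1, v 2] := by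
  ext j
  fin_cases j <;> simp [shearDeriv, shearMat, Matrix.mulVec, dotProduct, Fin.sum_univ_three]
  ring

/-- The shear is differentiable with derivative `shearDeriv`. [folklore] -/
theorem hasFDerivAt_shearMap (y : Fin 3 → ℝ) : HasFDerivAt shearMap shearDeriv y := by
  have p : ∀ i : Fin 3, HasFDerivAt (fun z : Fin 3 → ℝ => z i)
      (ContinuousLinearMap.proj (R := ℝ) (φ := fun _ : Fin 3 => ℝ) i) y :=
    fun i => hasFDerivAt_apply i y
  have c0 : HasFDerivAt (fun z : Fin 3 → ℝ => shearMap z 0)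
      ((ContinuousLinearMap.proj 0).comp shearDeriv) y := by
    have hfun : (fun z : Fin 3 → ℝ => shearMap z 0) = fun z => (2 : ℝ)⁻¹ * (z 0 - z 2 + 1) := by
      funext z
      rw [shearMap_zero]
      ring
    rw [hfun]
    refine ((((p 0).sub (p 2)).add_const 1).const_mul (2 : ℝ)⁻¹).congr_fderiv ?_
    ext v
    simp [shearDeriv_apply]
    ring
  have c1 : HasFDerivAt (fun z : Fin 3 → ℝ => shearMap z 1)
      ((ContinuousLinearMap.proj 1).comp shearDeriv) y := by
    have hfun : (fun z : Fin 3 → ℝ => shearMap z 1) = fun z => z 1 := by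
      funext z
      rw [shearMap_one]
    rw [hfun]
    refine (p 1).congr_fderiv ?_
    ext v
    simp [shearDeriv_apply]
  have c2 : HasFDerivAt (fun z : Fin 3 → ℝ => shearMap z 2)
      ((ContinuousLinearMap.proj 2).comp shearDeriv) y := by
    have hfun : (fun z : Fin 3 → ℝ => shearMap z 2) = fun z => z 2 := by
      funext z
      rw [shearMap_two]
    rw [hfun]
    refine (p 2).congr_fderiv ?_
    ext v
    simp [shearDeriv_apply]
  rw [hasFDerivAt_pi']
  intro i
  fin_cases i
  · exact c0
  · exact c1
  · exact c2

/-- The shear is injective. [folklore] -/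
theorem shearMap_injective : Function.Injective shearMap := by
  intro v v' h
  have h0 := congrFun h 0
  have h1 := congrFun h 1
  have h2 := congrFun h 2
  simp only [shearMap_zero, shearMap_one, shearMap_two] at h0 h1 h2
  funext j
  match j with
  | 0 => linarith
  | 1 => exact h1
  | 2 => exact h2

/-- The shear is a `ℚ`-semialgebraic map (affine with rational coefficients). [BCR1998 §2.2] -/
theorem isSemialgebraicMapOn_shearMap {s : Set (Fin 3 → ℝ)} (hs : IsSemialgebraic ℚ s) :
    IsSemialgebraicMapOn ℚ s shearMap := by
  refine IsSemialgebraicMapOn.of_forall hs fun j => ?_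
  match j with
  | 0 =>
    refine (isSemialgebraicFunOn_aeval hs
      (MvPolynomial.C (1 / 2 : ℚ) * (X 0 - X 2 + 1) : MvPolynomial (Fin 3) ℚ)).congr fun y _ => ?_
    simp only [map_mul, map_add, map_sub, map_one, MvPolynomial.aeval_C, MvPolynomial.aeval_X,
      shearMap_zero, eq_ratCast, Rat.cast_div, Rat.cast_one, Rat.cast_ofNat]
    ring
  | 1 => exact (isSemialgebraicFunOn_aeval hs (X 1)).congr fun y _ => by simp
  | 2 => exact (isSemialgebraicFunOn_aeval hs (X 2)).congr fun y _ => by simp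

namespace Quadric₃

variable (K : Quadric₃)

/-- The shear carries the Walsh cell of `K` onto the prism cell of `K.shear`. [this node] -/
theorem image_shearMap_cell : shearMap '' K.cell = K.shear.prismCell := by
  ext w
  simp only [mem_image, prismCell, cell, mem_setOf_eq, shear_pxyz, forall_fin_three]
  constructor
  · rintro ⟨v, ⟨⟨h0, h1, h2⟩, hp⟩, rfl⟩
    simp only [shearMap_zero, shearMap_one, shearMap_two]
    have e : 2 * ((v 0 - v 2 + 1) / 2) - 1 + v 2 = v 0 := by ring
    rw [e]
    refine ⟨⟨⟨⟨by linarith, by linarith⟩, h1, h2⟩, hp⟩, h0.1, h0.2⟩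
  · rintro ⟨⟨⟨h0, h1, h2⟩, hp⟩, ha, hb⟩
    refine ⟨![2 * w 0 - 1 + w 2, w 1, w 2], ⟨⟨?_, ?_, ?_⟩, ?_⟩, ?_⟩
    · simpa using And.intro ha hb
    · simpa using h1
    · simpa using h2
    · simpa using hp
    · funext j
      match j with
      | 0 => simp only [shearMap_zero, Matrix.cons_val_zero, Matrix.cons_val_two, Matrix.tail_cons,
          Matrix.head_cons]; ring
      | 1 => simp
      | 2 => simp

/-- **The shear move.** If `[prismCell(K.shear), 2q]` lands in the Baker sector modulo relations,
so does `[cell(K), q]`: ONE change of variables (rule (2)) by `Φ(x, y, z) = ((x − z + 1)/2, y, z)`,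
`|det Φ'| = 1/2`. [KontsevichZagier2001 §1.2 rule (2); this node] -/
theorem inBaker_cell3_of_shear (q : ℚ)
    (hP : ∀ ρ' : KZ.IntegralRep 3, ρ'.domain = K.shear.prismCell →
      (∀ w ∈ ρ'.domain, ρ'.integrand w = 2 * q) → InBaker (KZ.of ρ'))
    (ρ : KZ.IntegralRep 3) (hdom : ρ.domain = K.cell) (hint : ∀ z ∈ ρ.domain, ρ.integrand z = q) :
    InBaker (KZ.of ρ) := by
  set ρ' : KZ.IntegralRep 3 := polyRep₁ K.shear.prismCell K.shear.isSemialgebraic_prismCell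
    K.shear.prismCell_subset_Icc (MvPolynomial.C (2 * q)) with hρ'
  have hρ'i : ∀ w, ρ'.integrand w = 2 * q := fun w => by simp [hρ']
  have hB : InBaker (KZ.of ρ') := hP ρ' (by rw [hρ', polyRep₁_domain]) fun w _ => hρ'i w
  refine hB.congr (KZ.changeOfVariablesRel_subset_relations ⟨3, ρ, ρ', shearMap, fun _ => shearDeriv,
    isSemialgebraicMapOn_shearMap ρ.isSemialgebraic_domain,
    fun v _ => (hasFDerivAt_shearMap v).hasFDerivWithinAt, shearMap_injective.injOn, ?_, ?_, rfl⟩)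
  · rw [hρ', polyRep₁_domain, hdom]
    exact K.image_shearMap_cell.symm
  · intro v hv
    rw [hint v hv, hρ'i, det_shearDeriv, abs_of_pos (by norm_num : (0:ℝ) < 1 / 2)]
    ring

/-! #### 30.3 The swap `x ↔ y` and the multi-affine cells -/

/-- The normal form with `x` and `y` exchanged. [this node] -/
def swapXY : Quadric₃ := ⟨K.A, K.b0, K.b2, K.b1, K.c0, K.c2, K.c1, K.c22, K.c12, K.c11⟩

/-- `K.swapXY (x, y, z) = K (y, x, z)`. [this node] -/
theorem swapXY_pxyz (x y z : ℝ) : K.swapXY.pxyz x y z = K.pxyz y x z := by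
  simp only [swapXY, pxyz, Bxy, Cxy]
  ring

/-- `x ∘ (0 1) ∈ cell(K.swapXY) ↔ x ∈ cell(K)`. [this node] -/
theorem comp_swapXY_mem_cell_iff (x : Fin 3 → ℝ) :
    x ∘ ⇑(Equiv.swap (0 : Fin 3) 1) ∈ K.swapXY.cell ↔ x ∈ K.cell := by
  have h0 : (Equiv.swap (0 : Fin 3) 1) 0 = 1 := by decide
  have h1 : (Equiv.swap (0 : Fin 3) 1) 1 = 0 := by decide
  have h2 : (Equiv.swap (0 : Fin 3) 1) 2 = 2 := by decide
  have hp : ∀ j : Fin 3, (Equiv.swap (0 : Fin 3) 1) ((Equiv.swap (0 : Fin 3) 1) j) = j := by decide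
  simp only [cell, mem_setOf_eq, Function.comp_apply, h0, h1, h2, swapXY_pxyz,
    forall_cube_comp_iff _ hp]

/-- **Genuinely multi-affine cells are prism cells with a square term.** If every prism cell of a
normal form with `A ≠ 0` lands in the Baker sector modulo relations, then so does every genuinely
multi-affine cell (`A = c₁₁ = c₂₂ = 0`, `(b₁, b₂) ≠ 0`): shear along `x` if `b₁ ≠ 0` (square
coefficient `b₁`), else swap `x ↔ y` first (square coefficient `b₂`).
[KontsevichZagier2001 §1.2 rule (2); this node] -/
theorem inBaker_cell3_multiAffine_of_prism
    (hPr : ∀ L : Quadric₃, L.A ≠ 0 → ∀ (q : ℚ) (ρ : KZ.IntegralRep 3), ρ.domain = L.prismCell →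
      (∀ w ∈ ρ.domain, ρ.integrand w = q) → InBaker (KZ.of ρ))
    (K : Quadric₃) (hA : K.A = 0) (h11 : K.c11 = 0) (h22 : K.c22 = 0) (hb : ¬(K.b1 = 0 ∧ K.b2 = 0))
    (q : ℚ) (ρ : KZ.IntegralRep 3) (hdom : ρ.domain = K.cell)
    (hint : ∀ z ∈ ρ.domain, ρ.integrand z = q) : InBaker (KZ.of ρ) := by
  by_cases hb1 : K.b1 ≠ 0
  · refine K.inBaker_cell3_of_shear q (fun ρ' hd hi => hPr K.shear ?_ (2 * q) ρ' hd fun w hw => ?_)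
      ρ hdom hint
    · rw [shear_A, hA, h11]
      simpa using hb1
    · rw [hi w hw]
      push_cast
      ring
  · have hb2 : K.b2 ≠ 0 := fun h => hb ⟨not_not.mp hb1, h⟩
    refine K.inBaker_cell3_of_perm K.swapXY (Equiv.swap (0 : Fin 3) 1) (by decide)
      K.comp_swapXY_mem_cell_iff q (fun ρ' hd hi => ?_) ρ hdom hint
    refine K.swapXY.inBaker_cell3_of_shear q (fun ρ'' hd' hi' => hPr K.swapXY.shear ?_ (2 * q) ρ''
      hd' fun w hw => ?_) ρ' hd hi
    · rw [shear_A]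
      show K.A + K.b2 + K.c22 ≠ 0
      rw [hA, h22]
      simpa using hb2
    · rw [hi' w hw]
      push_cast
      ring

end Quadric₃

/-! #### 30.4 The quadric stratum `d ≤ 3` modulo `SqrtDescent₂` and prism cells with a square term -/

/-- **The support item `QuadricBakerDescent` modulo `SqrtDescent₂` and PRISM CELLS WITH A SQUARE
TERM.** The route item `Theses.RootDecompWalshStrata.QuadricBakerDescent`
(`stmt-KontsevichZagierPeriods-27597`) follows from (i) `SqrtDescent₂` for every normal form (`hS`,
spelled out) and (ii) `hPr`: every weighted prism cell
`[(0,1)³ ∩ {0 < 2x − 1 + z < 1} ∩ {L > 0}, q]` of a normal form `L` WITH `A ≠ 0` lands in the Baker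
sector modulo relations — the genuinely multi-affine residual of
`quadricBakerDescent_of_sqrtDescent₂_of_multiAffine` is discharged into (ii) by the shear move.
[KontsevichZagier2001 §1.2; this node (gen 5–7)] -/
theorem quadricBakerDescent_of_sqrtDescent₂_of_prism
    (hS : ∀ (K : Quadric₃) (γ : ℚ) (σ : Fin 5 → SignType) (r : KZ.IntegralRep 2),
      r.domain = K.atom σ →
        EqOn r.integrand (fun v => (γ : ℝ) * √(K.Dxy (v 0) (v 1))) r.domain → InBaker (KZ.of r))
    (hPr : ∀ L : Quadric₃, L.A ≠ 0 → ∀ (q : ℚ) (ρ : KZ.IntegralRep 3), ρ.domain = L.prismCell →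
      (∀ w ∈ ρ.domain, ρ.integrand w = q) → InBaker (KZ.of ρ)) :
    Summit.KontsevichZagierPeriods.KontsevichZagierPeriods.Theses.RootDecompWalshStrata.QuadricBakerDescent :=
  quadricBakerDescent_of_sqrtDescent₂_of_multiAffine hS fun K hA h11 h22 hb q ρ hd hi =>
    Quadric₃.inBaker_cell3_multiAffine_of_prism hPr K hA h11 h22 hb q ρ hd hi

end Summit.KontsevichZagierPeriods.RootDecompWalshStrata.ConicDescent.BallCube
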